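import Literature.NumberTheory.ComplexMultiplication.CMTypeRank
import Mathlib.GroupTheory.Sylow
import Mathlib.LinearAlgebra.Basis.VectorSpace
import HarnessLib

/-!
# The translates of a set of size prime to `p` span `ℚ^X` when `|X| = p^j` (the Kubota–Dodson rank of a weight
# vector of weight prime to `p` under a transitive group of prime-power degree is maximal)

COR-CM (cell `pub-hodgecm2`), literature seat `lit-deligne-3` (gen 11, claim PRIME-POWER-WEIGHT), count-neutral
own lane; the group-theoretic core of `CorCM/PrimePowerBlock/Nondegenerate.lean` (Dodson 1987 Prop. 4.1 in
prime-power form).  NEW AS STATED, hence under `Summits/`.  KERNEL ONLY: theorems; no definition, no named fact,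
no `sorry`.  Vocabulary of `Literature/NumberTheory/ComplexMultiplication/CMTypeRank.lean`: for a group `H` acting
on a finite set `X` and `f ⊆ X`, `translateInd f h = (x ↦ [h x ∈ f])` and `typeRank H f` = the `ℚ`-dimension of the
span of these indicator vectors (Kubota's rank [Kubota1965], Dodson's `r` [Dodson1984, §3.1.1]).

THEOREM (`translateSpan_eq_top_of_card_eq_prime_pow`, `typeRank_eq_card_of_card_eq_prime_pow`).  Let the finite
group `H` act transitively on `X` with `|X| = p^j` (`p` prime) and let `f ⊆ X` with `p ∤ |f|`.  Then the vectors
`x ↦ [h x ∈ f]`, `h ∈ H`, span `X → ℚ`; i.e. `typeRank H f = |X|`.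

PROOF.  (1) `isPretransitive_sylow_of_card_eq_prime_pow`: a Sylow `p`-subgroup `P` of `H` is transitive on `X`
([Dodson1987] Prop. 2.7, proof: "`(P₀ : P₀ ∩ H₀) = p^j`, so that coset representatives for `H₀` in `G₀` may be
selected from `P₀`.  Then `P₀` is a transitive subgroup") — orbit–stabiliser and `|P| = p^{v_p |H|}`.
(2) `eq_zero_of_forall_sum_translate_eq_zero`: for a `p`-group `P` transitive on `X`, a function `u : X → 𝔽_p`
with `Σ_{x : g x ∈ f} u(x) = 0` for all `g ∈ P` vanishes: the solutions form a `P`-stable `𝔽_p`-subspace, a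
non-zero one has `p ∣` its size and hence (fixed-point congruence for `p`-groups, Mathlib
`IsPGroup.exists_fixed_point_of_prime_dvd_card_of_fixed_point`) a NON-ZERO `P`-fixed solution, constant `= c` by
transitivity, and the equation at `g = 1` reads `|f|·c = 0`, i.e. `p ∣ |f|` — the permutation module `𝔽_p^X` of
a transitive `p`-group has the constants as its socle.  (3) A non-zero linear form on `X → ℚ` killing all
translates is a vector `v` with `Σ_{x : h x ∈ f} v(x) = 0` for all `h`; clearing denominators and dividing out
`p` gives an integral solution with a coordinate prime to `p`, whose reduction mod `p` contradicts (2) for `P`.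

## References
* [Dodson1987] B. Dodson, *On the Mumford–Tate group of an abelian variety with complex multiplication*, J. Algebra
  111 (1987), §2.3 Prop. 2.7 (proof, p. 62); §4.1 Prop. 4.1 (p. 67).
* [Dodson1984] B. Dodson, Trans. AMS 283 (1984), §3.1.1 (the rank `r` of the translates of a weight vector).
* [Kubota1965] T. Kubota, Trans. AMS 118 (1965), §4 (rank of a CM type).

Provenance: Literature home (family `hodge`, namespace `Literature.NumberTheory.ComplexMultiplication.PrimePowerBlock`) of the Summits-side `CorCM/PrimePowerBlock/TranslatesSpan` (cell `pub-hodgecm2`, COR-CM; all its imports are `Literature/` and Mathlib), which `Literature/` may not import; theorems only, no named fact, no definition. Nothing here bears on `HC_CM`. Lane `lit-hodgefound` (Layer A3: CM types, their Kubota ranks and Galois combinatorics), seat p20.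
-/

set_option autoImplicit false

open scoped BigOperators Pointwise

namespace Literature.NumberTheory.ComplexMultiplication.PrimePowerBlock

open Literature.NumberTheory.ComplexMultiplication

/-! ### §1 A Sylow `p`-subgroup of a transitive group of prime-power degree is transitive -/

section SylowTransitive

/-- **A Sylow `p`-subgroup of a finite group acting transitively on `p^j` points is transitive** (Dodson 1987
Prop. 2.7, proof: "Consider a `p`-Sylow subgroup `P₀` of `G₀`.  Observe that `(P₀ : P₀ ∩ H₀) = p^j`, so that coset
representatives for `H₀` in `G₀` may be selected from `P₀`.  Then `P₀` is a transitive subgroup of `G₀`").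
[cite: Dodson1987, Prop. 2.7 (proof)] -/
theorem isPretransitive_sylow_of_card_eq_prime_pow {H : Type*} [Group H] [Finite H] {X : Type*}
    [MulAction H X] [MulAction.IsPretransitive H X] {p j : ℕ} [hp : Fact p.Prime]
    (hX : Nat.card X = p ^ j) (P : Sylow p H) : MulAction.IsPretransitive P X := by
  classical
  have hX0 : Nat.card X ≠ 0 := by rw [hX]; exact pow_ne_zero _ hp.out.ne_zero
  haveI : Finite X := Nat.finite_of_card_ne_zero hX0
  obtain ⟨x₀⟩ : Nonempty X := (Nat.card_ne_zero.1 hX0).1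
  set S := MulAction.stabilizer H x₀ with hS
  have hS0 : Nat.card S ≠ 0 := Nat.card_pos.ne'
  have hH : Nat.card H = p ^ j * Nat.card S := by
    rw [← hX, ← MulAction.index_stabilizer_of_transitive H x₀, Subgroup.index_mul_card]
  -- the stabiliser of `x₀` in `P` is a `p`-group embedded in `S`
  set Q := MulAction.stabilizer P x₀ with hQ
  obtain ⟨a, ha⟩ := IsPGroup.iff_card.1 (P.isPGroup'.to_subgroup Q)
  have hQS : Nat.card Q ∣ Nat.card S := by
    let φ : Q →* S :=
      { toFun := fun q => ⟨((q : P) : H), by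
          have hq := q.2
          rw [MulAction.mem_stabilizer_iff] at hq ⊢
          exact hq⟩
        map_one' := rfl
        map_mul' := fun _ _ => rfl }
    refine Subgroup.card_dvd_of_injective φ fun q q' hqq' => ?_
    have h1 : (((q : P) : H)) = ((q' : P) : H) := congrArg (fun s : S => (s : H)) hqq'
    exact Subtype.ext (Subtype.ext h1)
  have hav : a ≤ (Nat.card S).factorization p := by
    rw [← hp.out.pow_dvd_iff_le_factorization hS0, ← ha]; exact hQS
  have hPcard : Nat.card P = p ^ (j + (Nat.card S).factorization p) := by
    rw [P.card_eq_multiplicity, hH, Nat.factorization_mul (pow_ne_zero _ hp.out.ne_zero) hS0,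
      Finsupp.add_apply, hp.out.factorization_pow, Finsupp.single_eq_same]
  -- orbit-stabiliser in `P`
  have horb : (MulAction.orbit P x₀).ncard * Nat.card Q = Nat.card P := by
    rw [hQ, ← MulAction.index_stabilizer, Subgroup.index_mul_card]
  have hle : (MulAction.orbit P x₀).ncard ≤ p ^ j := by
    rw [← hX, ← Set.ncard_univ]; exact Set.ncard_le_ncard (Set.subset_univ _)
  have hge : p ^ j ≤ (MulAction.orbit P x₀).ncard := by
    have h1 : (MulAction.orbit P x₀).ncard * p ^ a =
        p ^ j * p ^ ((Nat.card S).factorization p - a) * p ^ a := by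
      calc (MulAction.orbit P x₀).ncard * p ^ a = Nat.card P := by rw [← ha]; exact horb
        _ = p ^ j * p ^ ((Nat.card S).factorization p - a) * p ^ a := by
          rw [hPcard, mul_assoc, ← pow_add, Nat.sub_add_cancel hav, pow_add]
    have h3 := Nat.eq_of_mul_eq_mul_right (pow_pos hp.out.pos a) h1
    rw [h3]; exact Nat.le_mul_of_pos_right _ (pow_pos hp.out.pos _)
  have heq : MulAction.orbit P x₀ = Set.univ := by
    rw [Set.eq_univ_iff_ncard, hX]; exact le_antisymm hle hge
  refine ⟨fun x y => ?_⟩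
  have hx : x ∈ MulAction.orbit P x₀ := by rw [heq]; exact Set.mem_univ x
  have hy : y ∈ MulAction.orbit P x₀ := by rw [heq]; exact Set.mem_univ y
  obtain ⟨g, hg⟩ := MulAction.mem_orbit_iff.1 hx
  obtain ⟨g', hg'⟩ := MulAction.mem_orbit_iff.1 hy
  exact ⟨g' * g⁻¹, by rw [mul_smul, ← hg, inv_smul_smul, hg']⟩

end SylowTransitive

/-! ### §2 Over `𝔽_p`: a non-zero `P`-stable annihilator of the translates contains the constants -/

section ModP

variable {P : Type*} [Group P] {X : Type*} [MulAction P X] [Fintype X]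

/-- `#{x | x ∈ f} = |f|`. [cite: Dodson1987, Prop. 2.7 (proof)] -/
private theorem card_filter_mem_eq_ncard (f : Set X) [DecidablePred (· ∈ f)] :
    (Finset.univ.filter fun x => x ∈ f).card = f.ncard := by
  rw [← Set.ncard_coe_finset]
  congr 1
  ext x
  simp

/-- **The mod-`p` heart.**  Let a finite `p`-group `P` act transitively on the finite set `X`, and let `f ⊆ X` have
`p ∤ |f|`.  If `u : X → 𝔽_p` has `Σ_{x : g x ∈ f} u(x) = 0` for every `g ∈ P`, then `u = 0`.  (The solutions
form a `P`-stable `𝔽_p`-subspace; a non-zero one has `p ∣` its size, hence by the fixed-point congruence for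
`p`-groups a NON-ZERO `P`-fixed solution, which is a constant `c ≠ 0` by transitivity; the equation at `g = 1` reads
`|f|·c = 0`, i.e. `p ∣ |f|`.)  Equivalently: the socle of the permutation module `𝔽_p^X` of a transitive `p`-group
is the line of constants. [cite: Dodson1987, Prop. 2.7 (proof)] -/
theorem eq_zero_of_forall_sum_translate_eq_zero {p : ℕ} [hp : Fact p.Prime] [Finite P] (hP : IsPGroup p P)
    [MulAction.IsPretransitive P X] (f : Set X) [DecidablePred (· ∈ f)] (hf : ¬ p ∣ f.ncard)
    {u : X → ZMod p} (hu : ∀ g : P, ∑ x, (if g • x ∈ f then u x else 0) = 0) : u = 0 := by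
  classical
  by_contra hne
  -- the annihilator `U` of the translates, an `𝔽_p`-subspace
  let U : Submodule (ZMod p) (X → ZMod p) :=
    { carrier := {v | ∀ g : P, ∑ x, (if g • x ∈ f then v x else 0) = 0}
      add_mem' := fun {v w} hv hw g => by
        have h1 : ∑ x, (if g • x ∈ f then (v + w) x else 0) =
            ∑ x, (if g • x ∈ f then v x else 0) + ∑ x, (if g • x ∈ f then w x else 0) := by
          rw [← Finset.sum_add_distrib]
          exact Finset.sum_congr rfl fun x _ => by split_ifs <;> simp
        rw [h1, hv g, hw g, add_zero]
      zero_mem' := fun g => by simp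
      smul_mem' := fun c v hv g => by
        have h1 : ∑ x, (if g • x ∈ f then (c • v) x else 0) = c * ∑ x, (if g • x ∈ f then v x else 0) := by
          rw [Finset.mul_sum]
          exact Finset.sum_congr rfl fun x _ => by split_ifs <;> simp
        rw [h1, hv g, mul_zero] }
  have huU : u ∈ U := hu
  -- `P` acts on `U` by `(g • v)(x) = v(g⁻¹ x)`
  have hmem : ∀ (g : P) (v : X → ZMod p), v ∈ U → (fun x => v (g⁻¹ • x)) ∈ U := by
    intro g v hv k
    rw [← Equiv.sum_comp (MulAction.toPerm g)]
    refine Eq.trans (Finset.sum_congr rfl fun y _ => ?_) (hv (k * g))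
    simp only [MulAction.toPerm_apply, inv_smul_smul, mul_smul]
  letI : MulAction P U :=
    { smul := fun g v => ⟨fun x => (v : X → ZMod p) (g⁻¹ • x), hmem g v v.2⟩
      one_smul := fun v => Subtype.ext (funext fun x => by
        change (v : X → ZMod p) ((1 : P)⁻¹ • x) = (v : X → ZMod p) x
        rw [inv_one, one_smul])
      mul_smul := fun g g' v => Subtype.ext (funext fun x => by
        change (v : X → ZMod p) ((g * g')⁻¹ • x) = (v : X → ZMod p) (g'⁻¹ • g⁻¹ • x)
        rw [mul_inv_rev, mul_smul]) }
  have hsmul : ∀ (g : P) (v : U) (x : X), ((g • v : U) : X → ZMod p) x = (v : X → ZMod p) (g⁻¹ • x) :=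
    fun _ _ _ => rfl
  -- `p` divides `|U|` since `u ≠ 0` lies in it
  haveI : NeZero p := ⟨hp.out.ne_zero⟩
  have hpU : p ∣ Nat.card U := by
    have hord : addOrderOf (⟨u, huU⟩ : U) = p := by
      refine addOrderOf_eq_prime ?_ ?_
      · refine Subtype.ext (funext fun x => ?_)
        change (p • u) x = 0
        rw [Pi.smul_apply, nsmul_eq_mul, ZMod.natCast_self, zero_mul]
      · intro h0
        exact hne (congrArg Subtype.val h0)
    have hdvd := addOrderOf_dvd_natCard (⟨u, huU⟩ : U)
    rwa [hord] at hdvd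
  -- a non-zero `P`-fixed solution
  have h0fix : (0 : U) ∈ MulAction.fixedPoints P U := fun g => Subtype.ext (funext fun x => by
    rw [hsmul]; rfl)
  obtain ⟨b, hb, hb0⟩ := hP.exists_fixed_point_of_prime_dvd_card_of_fixed_point U hpU h0fix
  have hbfix : ∀ (g : P) (x : X), (b : X → ZMod p) (g⁻¹ • x) = (b : X → ZMod p) x := fun g x => by
    rw [← hsmul]; exact congrFun (congrArg Subtype.val (hb g)) x
  obtain ⟨x₀, hx₀⟩ : ∃ x, (b : X → ZMod p) x ≠ 0 := by
    by_contra hall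
    push Not at hall
    exact hb0 (Subtype.ext (funext fun x => (hall x).symm))
  have hconst : ∀ x, (b : X → ZMod p) x = (b : X → ZMod p) x₀ := fun x => by
    obtain ⟨g, hg⟩ := MulAction.exists_smul_eq P x₀ x
    rw [← hbfix g x, ← hg, inv_smul_smul]
  -- the equation at `g = 1`: `|f| · c = 0`
  have h1 := b.2 (1 : P)
  have h2 : ∑ x, (if x ∈ f then (b : X → ZMod p) x₀ else 0) = 0 := by
    refine Eq.trans (Finset.sum_congr rfl fun x _ => ?_) h1
    rw [one_smul, hconst x]
  rw [← Finset.sum_filter, Finset.sum_const, nsmul_eq_mul, card_filter_mem_eq_ncard] at h2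
  rcases mul_eq_zero.1 h2 with h3 | h3
  · exact hf ((ZMod.natCast_eq_zero_iff _ _).1 h3)
  · exact hx₀ h3

end ModP

/-! ### §3 Over `ℚ`: the translates of `f` span `ℚ^X` (`|X| = p^j`, `p ∤ |f|`) -/

section Span

variable {X : Type*} [Fintype X]

/-- Clearing denominators: a non-zero rational solution of finitely many equations `Σ_{x ∈ S_i} v(x) = 0` gives a
non-zero integral one. [cite: Dodson1987, Prop. 2.7 (proof)] -/
private theorem exists_int_of_rat {ι : Type*} (S : ι → Finset X) {v : X → ℚ} (hv : v ≠ 0)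
    (h : ∀ i, ∑ x ∈ S i, v x = 0) : ∃ w : X → ℤ, w ≠ 0 ∧ ∀ i, ∑ x ∈ S i, w x = 0 := by
  classical
  set D : ℚ := ∏ y, ((v y).den : ℚ) with hD
  have hD0 : D ≠ 0 := Finset.prod_ne_zero_iff.2 fun y _ => Nat.cast_ne_zero.2 (v y).den_nz
  let w : X → ℤ := fun x => (v x).num * ∏ y ∈ Finset.univ.erase x, ((v y).den : ℤ)
  have hw : ∀ x, (w x : ℚ) = v x * D := fun x => by
    simp only [w, Int.cast_mul, Int.cast_prod, Int.cast_natCast]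
    rw [hD, ← Finset.mul_prod_erase Finset.univ (fun y => ((v y).den : ℚ)) (Finset.mem_univ x), ← mul_assoc,
      Rat.mul_den_eq_num]
  refine ⟨w, fun hw0 => hv (funext fun x => ?_), fun i => ?_⟩
  · have h1 : (w x : ℚ) = 0 := by rw [congrFun hw0 x]; simp
    rw [hw x] at h1
    exact (mul_eq_zero.1 h1).resolve_right hD0
  · have h1 : ((∑ x ∈ S i, w x : ℤ) : ℚ) = 0 := by
      rw [Int.cast_sum]
      simp_rw [hw]
      rw [← Finset.sum_mul, h i, zero_mul]
    exact_mod_cast h1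

/-- `p`-primitivity: an integral solution with a coordinate prime to `p` (divide out common factors `p`; descent
on `Σ |w(x)|`). [cite: Dodson1987, Prop. 2.7 (proof)] -/
private theorem exists_not_dvd {ι : Type*} (S : ι → Finset X) {p : ℕ} (hp : 1 < p) :
    ∀ (N : ℕ) (w : X → ℤ), ∑ x, (w x).natAbs = N → w ≠ 0 → (∀ i, ∑ x ∈ S i, w x = 0) →
      ∃ w' : X → ℤ, (∀ i, ∑ x ∈ S i, w' x = 0) ∧ ∃ x, ¬ (p : ℤ) ∣ w' x := by
  intro N
  induction N using Nat.strong_induction_on with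
  | _ N ih =>
  intro w hN hw0 hS
  by_cases hall : ∀ x, (p : ℤ) ∣ w x
  · choose w' hw' using hall
    have hw'0 : w' ≠ 0 := fun h0 => hw0 (funext fun x => by
      rw [hw' x, congrFun h0 x, Pi.zero_apply, mul_zero])
    have hS' : ∀ i, ∑ x ∈ S i, w' x = 0 := fun i => by
      have h1 : (p : ℤ) * ∑ x ∈ S i, w' x = 0 := by
        rw [Finset.mul_sum, ← hS i]
        exact Finset.sum_congr rfl fun x _ => (hw' x).symm
      exact (mul_eq_zero.1 h1).resolve_left (by exact_mod_cast (by omega : p ≠ 0))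
    have hsum : ∑ x, (w x).natAbs = p * ∑ x, (w' x).natAbs := by
      rw [Finset.mul_sum]
      exact Finset.sum_congr rfl fun x _ => by rw [hw' x, Int.natAbs_mul, Int.natAbs_natCast]
    have hpos : 0 < ∑ x, (w' x).natAbs := by
      obtain ⟨x, hx⟩ := Function.ne_iff.1 hw'0
      exact Finset.sum_pos' (fun _ _ => Nat.zero_le _) ⟨x, Finset.mem_univ _, Int.natAbs_pos.2 hx⟩
    have hlt : ∑ x, (w' x).natAbs < N := by
      rw [← hN, hsum]; exact lt_mul_left hpos hp
    exact ih _ hlt w' rfl hw'0 hS'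
  · push Not at hall
    exact ⟨w, hS, hall⟩

/-- **The translates of a set of size prime to `p` span `ℚ^X` when `|X| = p^j`.**  For a finite group `H` acting
transitively on `X` with `|X| = p^j` and `f ⊆ X` with `p ∤ |f|`, the indicator vectors `x ↦ [h x ∈ f]`, `h ∈ H`,
span all of `X → ℚ`.  (A non-zero linear form vanishing on them is a vector `v` with `Σ_{x : hx ∈ f} v(x) = 0` for
all `h`; scale it to an integral vector with a coordinate prime to `p` and reduce mod `p`: the previous lemma, for a
Sylow `p`-subgroup of `H` — transitive by `isPretransitive_sylow_of_card_eq_prime_pow` —, says the reduction is `0`.)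
 [cite: Dodson1987, Prop. 2.7 (proof)] -/
theorem translateSpan_eq_top_of_card_eq_prime_pow {H : Type*} [Group H] [Finite H] [MulAction H X]
    [MulAction.IsPretransitive H X] {p j : ℕ} (hp : p.Prime) (hX : Fintype.card X = p ^ j)
    (f : Set X) (hf : ¬ p ∣ f.ncard) :
    Submodule.span ℚ (Set.range fun h : H => translateInd f h) = ⊤ := by
  classical
  haveI := Fact.mk hp
  by_contra hne
  obtain ⟨φ, hφ0, hle⟩ := Submodule.exists_le_ker_of_lt_top _ (lt_top_iff_ne_top.2 hne)
  -- the linear form as a vector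
  let v : X → ℚ := fun x => φ fun y => if x = y then 1 else 0
  have hφv : ∀ u : X → ℚ, φ u = ∑ x, u x * v x := fun u => by
    rw [LinearMap.pi_apply_eq_sum_univ φ u]; rfl
  have hv0 : v ≠ 0 := fun h0 => hφ0 (LinearMap.ext fun u => by
    rw [hφv, LinearMap.zero_apply]
    exact Finset.sum_eq_zero fun x _ => by rw [congrFun h0 x, Pi.zero_apply, mul_zero])
  have hvS : ∀ h : H, ∑ x ∈ Finset.univ.filter (fun x => h • x ∈ f), v x = 0 := fun h => by
    have hk : translateInd f h ∈ LinearMap.ker φ := hle (Submodule.subset_span ⟨h, rfl⟩)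
    rw [LinearMap.mem_ker, hφv] at hk
    rw [Finset.sum_filter]
    refine Eq.trans (Finset.sum_congr rfl fun x _ => ?_) hk
    by_cases hx : h • x ∈ f
    · rw [if_pos hx, translateInd_of_mem hx, one_mul]
    · rw [if_neg hx, translateInd_of_not_mem hx, zero_mul]
  obtain ⟨w, hw0, hwS⟩ := exists_int_of_rat (fun h : H => Finset.univ.filter fun x => h • x ∈ f) hv0 hvS
  obtain ⟨w', hw'S, x₁, hx₁⟩ :=
    exists_not_dvd (fun h : H => Finset.univ.filter fun x => h • x ∈ f) hp.one_lt _ w rfl hw0 hwS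
  -- a Sylow `p`-subgroup is transitive; reduce mod `p`
  obtain ⟨P⟩ := (Sylow.nonempty : Nonempty (Sylow p H))
  haveI : MulAction.IsPretransitive P X :=
    isPretransitive_sylow_of_card_eq_prime_pow (by rw [Nat.card_eq_fintype_card, hX]) P
  have key := eq_zero_of_forall_sum_translate_eq_zero P.isPGroup' f hf (u := fun x => (w' x : ZMod p))
    fun g => by
      have h1 := hw'S (g : H)
      rw [Finset.sum_filter] at h1
      have h2 := congrArg (Int.cast : ℤ → ZMod p) h1
      rw [Int.cast_sum, Int.cast_zero] at h2
      refine Eq.trans (Finset.sum_congr rfl fun x _ => ?_) h2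
      rw [Subgroup.smul_def]
      split_ifs <;> simp
  have h3 : (w' x₁ : ZMod p) = 0 := congrFun key x₁
  exact hx₁ ((ZMod.intCast_zmod_eq_zero_iff_dvd _ _).1 h3)

/-- **`typeRank H f = |X|`** for `H` transitive on `X`, `|X| = p^j`, `p ∤ |f|`: the Kubota–Dodson rank of `f` under
`H` is maximal. [cite: Dodson1987, Prop. 2.7 (proof)] -/
theorem typeRank_eq_card_of_card_eq_prime_pow {H : Type*} [Group H] [Finite H] [MulAction H X]
    [MulAction.IsPretransitive H X] {p j : ℕ} (hp : p.Prime) (hX : Fintype.card X = p ^ j)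
    (f : Set X) (hf : ¬ p ∣ f.ncard) : typeRank H f = Fintype.card X := by
  rw [typeRank, translateSpan_eq_top_of_card_eq_prime_pow hp hX f hf, finrank_top,
    Module.finrank_fintype_fun_eq_card]

end Span

end Literature.NumberTheory.ComplexMultiplication.PrimePowerBlock
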